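import Literature.AlgebraicGeometry.Motives.AbelianVarietyEquivariantFactorCharacter
import Literature.AlgebraicGeometry.Motives.AbelianVarietyPointCountIsogenyInvariance
import HarnessLib

/-!
# Frobenius traces of Kani–Rosen and isotypical factors over a finite field:
# `|H| · Tr(π_{B_H}^m | T_ℓ B_H) = Σ_{h ∈ H} Tr(ρ(h) π_X^m | T_ℓ X)` and `|G| · Tr(π_{B_W}^m | T_ℓ B_W) = Σ_g c_W(g) Tr(ρ(g) π_X^m | T_ℓ X)`
# — the Frobenius of a `G`-stable factor through TWISTED FROBENIUS TRACES of `X` (ALGEBRAIC carrier)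

Let `X` be an abelian variety over a finite field `K = 𝔽_q` with Frobenius endomorphism `π_X` (`frobeniusHom`), acted on
by a finite group through `ρ : G → End X`, and `ℓ ∤ q` a prime.  Since `π` commutes with every homomorphism
(`frobeniusHom_comp`: "for any map `φ : W → V`, `φ ∘ π_W = π_V ∘ φ`"), the Frobenius of an abelian subvariety `Im u ↪ X`
is the RESTRICTION of `π_X` (§1, `imageRestrict_frobeniusHom(_pow)`), and the prequel's trace identity
`Tr(T_ℓ(b ≫ u) | T_ℓ X) = a · Tr(T_ℓ(b|_{Im u}) | T_ℓ Im u)` (`Motives/AbelianVarietyEquivariantFactorCharacter`, for a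
quasi-idempotent `u² = a u` and `b` commuting with `u`) applies to `b = π_X^m`:

  `Tr(T_ℓ(π_X^m ≫ u) | T_ℓ X) = a · Tr(T_ℓ(π_{Im u})^m | T_ℓ(Im u))`          (§2, `trace_tateModuleMap_frobeniusHom_pow_comp_eq`).

For Kani–Rosen's `B_H = Im N_H`, `N_H = Σ_{h ∈ H} ρ(h)` (`a = |H|`) and for the isotypical factors `B_W = Im u_W`,
`u_W = Σ_g c_W(g) ρ(g) = |G| ρ̄(e_W)` (`a = |G|`, `Motives/AbelianVarietyGroupActionIsotypicalDecomposition`) this is (§3)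

  **`|H| · Tr(T_ℓ(π_{B_H})^m) = Σ_{h ∈ H} τ_m(h)`**,   **`|G| · Tr(T_ℓ(π_{B_W})^m) = Σ_{g ∈ G} c_W(g) τ_m(g)`**,
  with the TWISTED FROBENIUS TRACES  `τ_m(g) := Tr(T_ℓ ρ(g) ∘ T_ℓ(π_X)^m | T_ℓ X) = Tr(ρ(g) φ^m | T_ℓ X)`

(`T_ℓ(π_X) = ρ_X(φ)`, `φ` the arithmetic Frobenius) — the `ℓ`-adic content of the classical recipe for the zeta function
of a quotient: the Frobenius traces of `Jac(X/H) ∼ B_H` are the AVERAGES over `H` of the `h`-twisted Frobenius traces of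
`J_X` ("`H¹_ℓ(X)^H ≃ H¹_ℓ(X/H)` as Galois modules"; by the Lefschetz formula — not used here — `τ_m(h)` counts the fixed
points of `h ∘ F^m`).  `g ↦ τ_m(g)` is a CLASS FUNCTION (`π_X^m` commutes with `ρ(G)`), so Frobenius reciprocity in
counting form gives the version linear in the permutation character, `|G||H| · Tr(T_ℓ(π_{B_H})^m) = Σ_g m_H(g) τ_m(g)`
(`m_H(g) = |{x : x⁻¹gx ∈ H}|`); at `m = 0` all of this is the prequels' dimension formula `|H| · 2 dim B_H = Σ_h χ_ℓ(h)`.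

## Main statements (sorry-free; theorems only, no new definitions)

* §1 `tateModuleMap_end_pow` (`T_ℓ(f^m) = (T_ℓ f)^m`), **`imageRestrict_frobeniusHom`**, `imageRestrict_frobeniusHom_pow`
  (`π_Y|_{Im f} = π_{Im f}`, finite field).
* §2 **`trace_tateModuleMap_frobeniusHom_pow_comp_eq`** (`Tr(T_ℓ(π_X^m ≫ u)) = a · Tr(T_ℓ(π_{Im u})^m)` for `u² = a u`).
* §3 `tateModuleMap_asHom_comm_frobeniusHom_pow`, **`trace_tateModuleMap_asHom_conj_comp_frobeniusHom_pow`** (`τ_m` is a class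
  function), **`card_mul_trace_frobeniusHom_pow_image_norm_eq_sum`** (`|H| Tr(T_ℓ(π_{B_H})^m) = Σ_{h ∈ H} τ_m(h)`),
  `card_mul_trace_tateRep_arithFrob_pow_image_norm_eq_sum` (the same with `ρ_{B_H}(φ^m)`, `ρ_X(φ^m)`),
  `card_mul_card_mul_trace_frobeniusHom_pow_image_norm_eq_sum` (marks form `Σ_g m_H(g) τ_m(g)`),
  **`card_mul_trace_frobeniusHom_pow_isotypical_eq_sum`** (`|G| Tr(T_ℓ(π_{B_W})^m) = Σ_g c_W(g) τ_m(g)`).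

Scope (stated, not hidden).  `K` finite and `ℓ` invertible in `K` throughout §2–§3; the identities are in `ℤ_ℓ` for the
Frobenius ENDOMORPHISM `π_B` of each factor (no point counts `#B_H(𝔽_{q^m})` and no Lefschetz fixed-point formula are
claimed); `B_H = Im N_H`, `B_W = Im u_W` as in the prequels; no integrality or `ℓ`-independence of `τ_m(g)` is asserted.

## References

* [Milne1986AbelianVarieties] J. S. Milne, *Abelian varieties*, in Cornell–Silverman (1986), §19, proof of Thm. 19.1
  (pp. 144–145: `π` commutes with all maps; `P_A = charpoly(π_A | T_ℓ A)`), §12 Prop. 12.9.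
* [Tate1966Endomorphisms] J. Tate, *Endomorphisms of abelian varieties over finite fields*, Invent. Math. 2 (1966), §1.
* [DokchitserEtAl2022] V. Dokchitser, H. Green, A. Konstantinou, A. Morgan, *Parity of ranks of Jacobians of curves*,
  arXiv:2211.06357, §3 (additive functor lemma, `F = V_ℓ`) and proof of Thm. 8.4 (`H¹_ℓ(X)^H ≃ H¹_ℓ(X/H)` as Galois modules).
* [LangeRodriguez2022] H. Lange, R. E. Rodríguez, *Decomposition of Jacobians by Prym Varieties*, LNM 2310 (2022), §2.9.1
  Thm. 2.9.1, Prop. 2.9.3 (PDF pp. 43, 46).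
* [KaniRosen1989] E. Kani, M. Rosen, *Idempotent relations and factors of Jacobians*, Math. Ann. 284 (1989), §3, Thm. B.
* [MumfordAV1970] D. Mumford, *Abelian Varieties* (1970), §19 Thm. 1 (p. 173), Thm. 3 (p. 176), §21.
-/

noncomputable section

open CategoryTheory CategoryTheory.Limits
open Literature.RepresentationTheory.FiniteGroups
open Literature.NumberTheory.DiophantineGeometry

universe u

namespace Literature.AlgebraicGeometry.Motives

namespace AbelianVariety

/-! ## §1 `T_ℓ` of powers; the Frobenius of an image is the restricted Frobenius -/

section Powers

variable {K : Type u} [Field K] (ℓ : ℕ) [Fact ℓ.Prime] {X Y : AbelianVariety K}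

/-- `T_ℓ(f^m) = (T_ℓ f)^m` for an endomorphism `f` (functoriality of `T_ℓ`; powers taken in `End X`, resp. `End(T_ℓ X)`).
[cite: MumfordAV1970, §19 Thm. 3 (p. 176)] -/
theorem tateModuleMap_end_pow (f : X ⟶ X) (m : ℕ) :
    tateModuleMap ℓ ((End.of f ^ m : End X) : X ⟶ X) = tateModuleMap ℓ f ^ m := by
  induction m with
  | zero => rw [pow_zero, pow_zero, End.one_def, tateModuleMap_id]; rfl
  | succ m ih =>
    rw [pow_succ, pow_succ, End.mul_def, tateModuleMap_comp]
    change tateModuleMap ℓ ((End.of f ^ m : End X) : X ⟶ X) ∘ₗ tateModuleMap ℓ f = _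
    rw [ih]
    rfl

variable [Finite K]

/-- **The Frobenius of `Im f` is the restriction of the Frobenius**: `π_Y|_{Im f} = π_{Im f}` for every homomorphism
`f : X → Y` over a finite field (`π` commutes with `f` and with `Im f ↪ Y`, and restrictions to `Im f` are unique).
[cite: Milne1986AbelianVarieties, §19, proof of Thm. 19.1 (p. 144: "φ ∘ π_W = π_V ∘ φ")] [cite: MumfordAV1970, §19 Thm. 1 (p. 173)] -/
theorem imageRestrict_frobeniusHom (f : X ⟶ Y) :
    imageRestrict f (frobeniusHom X) (frobeniusHom Y) (frobeniusHom_comp f) = frobeniusHom (image f) :=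
  (imageRestrict_unique f _ _ (frobeniusHom_comp f) (frobeniusHom (image f)) (frobeniusHom_comp (imageι f))).symm

/-- `π_Y^m|_{Im f} = π_{Im f}^m`. [cite: Milne1986AbelianVarieties, §19, proof of Thm. 19.1 (p. 144)] [cite: MumfordAV1970, §19 Thm. 1 (p. 173)] -/
theorem imageRestrict_frobeniusHom_pow (f : X ⟶ Y) (m : ℕ) :
    imageRestrict f ((End.of (frobeniusHom X) ^ m : End X) : X ⟶ X) ((End.of (frobeniusHom Y) ^ m : End Y) : Y ⟶ Y)
        (frobeniusHom_pow_comp f m) =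
      ((End.of (frobeniusHom (image f)) ^ m : End (image f)) : image f ⟶ image f) :=
  (imageRestrict_unique f _ _ (frobeniusHom_pow_comp f m) _ (frobeniusHom_pow_comp (imageι f) m)).symm

end Powers

/-! ## §2 `Tr(T_ℓ(π_X^m ≫ u) | T_ℓ X) = a · Tr(T_ℓ(π_{Im u})^m | T_ℓ(Im u))` for a quasi-idempotent `u` -/

section Factor

variable {K : Type u} [Field K] [Finite K] (ℓ : ℕ) [Fact ℓ.Prime] {X : AbelianVariety K} {u : X ⟶ X} {a : ℕ}

/-- **Frobenius traces of the factor `Im u` through `X`**: for a quasi-idempotent `u ≫ u = a • u` over a finite field and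
`ℓ ∤ q`, `Tr(T_ℓ(π_X^m ≫ u) | T_ℓ X) = a · Tr(T_ℓ(π_{Im u})^m | T_ℓ(Im u))` for every `m` (`π_X^m` commutes with `u`
and restricts to `π_{Im u}^m`; the prequel's `trace_tateModuleMap_comp_eq_mul_trace_imageRestrict`).
[cite: DokchitserEtAl2022, §3 (additive functor lemma, `F = V_ℓ`)] [cite: Milne1986AbelianVarieties, §19, proof of Thm. 19.1 (pp. 144–145)] -/
theorem trace_tateModuleMap_frobeniusHom_pow_comp_eq (hu : u ≫ u = a • u) (hℓ : (ℓ : K) ≠ 0) (m : ℕ) :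
    LinearMap.trace ℤ_[ℓ] (X.tateModule ℓ) (tateModuleMap ℓ (((End.of (frobeniusHom X) ^ m : End X) : X ⟶ X) ≫ u)) =
      a * LinearMap.trace ℤ_[ℓ] ((image u).tateModule ℓ) (tateModuleMap ℓ (frobeniusHom (image u)) ^ m) := by
  rw [trace_tateModuleMap_comp_eq_mul_trace_imageRestrict_of_ne_zero ℓ hu _ (frobeniusHom_pow_comp u m) hℓ,
    imageRestrict_frobeniusHom_pow, tateModuleMap_end_pow]

end Factor

/-! ## §3 Twisted Frobenius traces: `|H| Tr(T_ℓ(π_{B_H})^m) = Σ_{h ∈ H} τ_m(h)`, `|G| Tr(T_ℓ(π_{B_W})^m) = Σ_g c_W(g) τ_m(g)` -/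

section Twisted

variable {K : Type u} [Field K] [Finite K] (ℓ : ℕ) [Fact ℓ.Prime] {X : AbelianVariety K} {G : Type} [Group G]
  (ρ : G →* End X)

/-- A conjugation identity for traces: `Tr(A B A⁻¹ P) = Tr(B P)` when `A⁻¹ A = 1` and `P` commutes with `A⁻¹`. [folklore] -/
private theorem trace_mul_mul_mul_eq_of_comm {R M : Type*} [CommRing R] [AddCommGroup M] [Module R M]
    (A B Ai P : Module.End R M) (hinv : Ai * A = 1) (hP : Ai * P = P * Ai) :
    LinearMap.trace R M (A * B * Ai * P) = LinearMap.trace R M (B * P) := by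
  calc LinearMap.trace R M (A * B * Ai * P) = LinearMap.trace R M ((A * (B * P)) * Ai) := by
        rw [mul_assoc (A * B), hP, ← mul_assoc, mul_assoc A]
    _ = LinearMap.trace R M (Ai * (A * (B * P))) := LinearMap.trace_mul_comm R _ _
    _ = LinearMap.trace R M (B * P) := by rw [← mul_assoc, hinv, one_mul]

/-- `T_ℓ ρ(x)` commutes with `T_ℓ(π_X^m)` (`π` commutes with every endomorphism). [cite: Milne1986AbelianVarieties, §19, proof of Thm. 19.1 (p. 144)]
[cite: Tate1966Endomorphisms, §1] -/
theorem tateModuleMap_asHom_comm_frobeniusHom_pow (x : G) (m : ℕ) :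
    tateModuleMap ℓ (End.asHom (ρ x)) * tateModuleMap ℓ ((End.of (frobeniusHom X) ^ m : End X) : X ⟶ X) =
      tateModuleMap ℓ ((End.of (frobeniusHom X) ^ m : End X) : X ⟶ X) * tateModuleMap ℓ (End.asHom (ρ x)) := by
  change tateModuleMap ℓ (End.asHom (ρ x)) ∘ₗ tateModuleMap ℓ ((End.of (frobeniusHom X) ^ m : End X) : X ⟶ X) =
    tateModuleMap ℓ ((End.of (frobeniusHom X) ^ m : End X) : X ⟶ X) ∘ₗ tateModuleMap ℓ (End.asHom (ρ x))
  rw [← tateModuleMap_comp, ← tateModuleMap_comp, frobeniusHom_pow_comp]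

/-- **The twisted Frobenius traces `τ_m(g) = Tr(T_ℓ ρ(g) ∘ T_ℓ(π_X)^m | T_ℓ X)` form a CLASS FUNCTION of `g`**:
`τ_m(a g a⁻¹) = τ_m(g)` (`T_ℓ(π_X^m)` commutes with `T_ℓ ρ(a)`, and `Tr(AB) = Tr(BA)`).
[cite: DokchitserEtAl2022, §3 (additive functor lemma, `F = V_ℓ`) and proof of Thm. 8.4] [cite: Milne1986AbelianVarieties, §19, proof of Thm. 19.1 (p. 144)] -/
theorem trace_tateModuleMap_asHom_conj_comp_frobeniusHom_pow (a g : G) (m : ℕ) :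
    LinearMap.trace ℤ_[ℓ] (X.tateModule ℓ)
        (tateModuleMap ℓ (End.asHom (ρ (a * g * a⁻¹))) ∘ₗ tateModuleMap ℓ (frobeniusHom X) ^ m) =
      LinearMap.trace ℤ_[ℓ] (X.tateModule ℓ) (tateModuleMap ℓ (End.asHom (ρ g)) ∘ₗ tateModuleMap ℓ (frobeniusHom X) ^ m) := by
  rw [← tateModuleMap_end_pow]
  change LinearMap.trace ℤ_[ℓ] (X.tateModule ℓ)
      (tateModuleMap ℓ (End.asHom (ρ (a * g * a⁻¹))) * tateModuleMap ℓ ((End.of (frobeniusHom X) ^ m : End X) : X ⟶ X)) =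
    LinearMap.trace ℤ_[ℓ] (X.tateModule ℓ)
      (tateModuleMap ℓ (End.asHom (ρ g)) * tateModuleMap ℓ ((End.of (frobeniusHom X) ^ m : End X) : X ⟶ X))
  rw [tateModuleMap_asHom_map_mul, tateModuleMap_asHom_map_mul]
  refine trace_mul_mul_mul_eq_of_comm _ _ _ _ ?_ (tateModuleMap_asHom_comm_frobeniusHom_pow ℓ ρ a⁻¹ m)
  rw [← tateModuleMap_asHom_map_mul, inv_mul_cancel, tateModuleMap_asHom_map_one]

variable {H : Subgroup G} [Fintype H] {N : X ⟶ X}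

/-- **`|H| · Tr(T_ℓ(π_{B_H})^m | T_ℓ B_H) = Σ_{h ∈ H} Tr(T_ℓ ρ(h) ∘ T_ℓ(π_X)^m | T_ℓ X)`** for `B_H = Im N_H`,
`N_H = Σ_{h ∈ H} ρ(h)`, over a finite field with `ℓ ∤ q`, every `m ∈ ℕ`: the Frobenius traces of the Kani–Rosen factor are
the averages over `H` of the TWISTED Frobenius traces of `X` (`V_ℓ(B_H) ≅ V_ℓ(X)^H` and `Tr(F | V^H) = |H|⁻¹ Σ_h Tr(hF | V)`;
for a curve: the numerator of `Z(X/H, t)` from the `h ∘ F^m`-twisted traces on `H¹_ℓ(J_X)`).  At `m = 0`: the prequel's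
`|H| · 2 dim B_H = Σ_h χ_ℓ(h)`. [cite: DokchitserEtAl2022, §3 (additive functor lemma, `F = V_ℓ`) and proof of Thm. 8.4 (`H¹_ℓ(X)^H ≃ H¹_ℓ(X/H)`)]
[cite: Milne1986AbelianVarieties, §19, proof of Thm. 19.1 (pp. 144–145)] [cite: KaniRosen1989, §3 (`B_H = ε_H(J)`)] -/
theorem card_mul_trace_frobeniusHom_pow_image_norm_eq_sum (hN : End.of N = ∑ h : H, ρ h) (hℓ : (ℓ : K) ≠ 0) (m : ℕ) :
    (Fintype.card H : ℤ_[ℓ]) * LinearMap.trace ℤ_[ℓ] ((image N).tateModule ℓ) (tateModuleMap ℓ (frobeniusHom (image N)) ^ m) =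
      ∑ h : H, LinearMap.trace ℤ_[ℓ] (X.tateModule ℓ)
        (tateModuleMap ℓ (End.asHom (ρ h)) ∘ₗ tateModuleMap ℓ (frobeniusHom X) ^ m) := by
  have hN' : N = ∑ h : H, End.asHom (ρ h) := hN
  rw [← trace_tateModuleMap_frobeniusHom_pow_comp_eq ℓ (norm_comp_norm_eq_card_nsmul ρ hN) hℓ m, hN', Preadditive.comp_sum,
    tateModuleMap_sum, map_sum]
  refine Finset.sum_congr rfl fun h _ ↦ ?_
  rw [tateModuleMap_comp, tateModuleMap_end_pow]

/-- The same through the arithmetic Frobenius `φ ∈ Gal(K̄/K)` (`T_ℓ(π_A) = ρ_A(φ)`):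
**`|H| · Tr(ρ_{B_H}(φ^m) | T_ℓ B_H) = Σ_{h ∈ H} Tr(T_ℓ ρ(h) ∘ ρ_X(φ^m) | T_ℓ X)`**.
[cite: Milne1986AbelianVarieties, §19, proof of Thm. 19.1 (p. 144: "π_A induces (x_i) ↦ (x_i^q)")] [cite: DokchitserEtAl2022, proof of Thm. 8.4] -/
theorem card_mul_trace_tateRep_arithFrob_pow_image_norm_eq_sum (hN : End.of N = ∑ h : H, ρ h) (hℓ : (ℓ : K) ≠ 0) (m : ℕ) :
    (Fintype.card H : ℤ_[ℓ]) * LinearMap.trace ℤ_[ℓ] ((image N).tateModule ℓ) ((image N).tateRep ℓ (arithFrob K ^ m)) =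
      ∑ h : H, LinearMap.trace ℤ_[ℓ] (X.tateModule ℓ)
        (tateModuleMap ℓ (End.asHom (ρ h)) ∘ₗ X.tateRep ℓ (arithFrob K ^ m)) := by
  rw [((image N).tateRep ℓ).map_pow, (X.tateRep ℓ).map_pow, ← tateModuleMap_frobeniusHom_eq_tateRep_arithFrob,
    ← tateModuleMap_frobeniusHom_eq_tateRep_arithFrob]
  exact card_mul_trace_frobeniusHom_pow_image_norm_eq_sum ℓ ρ hN hℓ m

variable [Fintype G]

/-- **The form linear in the permutation character**: `|G| |H| · Tr(T_ℓ(π_{B_H})^m) = Σ_{g ∈ G} m_H(g) τ_m(g)` with the marks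
`m_H(g) = |{x : x⁻¹ g x ∈ H}| = |H| (1_H)^G(g)` (Frobenius reciprocity in counting form for the class function `τ_m`); hence
the Frobenius traces of the `B_{H_i}` satisfy every Brauer relation of `G` (which the tree also derives from the isogenies,
`Motives/AbelianVarietyGaloisCharpolyIsogenyRelations`). [cite: DokchitserEtAl2022, §1.3 Thm. 1.3 and proof of Thm. 8.4]
[cite: KaniRosen1989, Thm. 3] -/
theorem card_mul_card_mul_trace_frobeniusHom_pow_image_norm_eq_sum (hN : End.of N = ∑ h : H, ρ h) (hℓ : (ℓ : K) ≠ 0)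
    (m : ℕ) :
    (Fintype.card G : ℤ_[ℓ]) * Fintype.card H *
        LinearMap.trace ℤ_[ℓ] ((image N).tateModule ℓ) (tateModuleMap ℓ (frobeniusHom (image N)) ^ m) =
      ∑ g, (Nat.card {x : G // x⁻¹ * g * x ∈ H} : ℤ_[ℓ]) *
        LinearMap.trace ℤ_[ℓ] (X.tateModule ℓ) (tateModuleMap ℓ (End.asHom (ρ g)) ∘ₗ tateModuleMap ℓ (frobeniusHom X) ^ m) := by
  have h := card_smul_sum_subgroup_eq_sum_card_conj_smul H
    (fun g ↦ LinearMap.trace ℤ_[ℓ] (X.tateModule ℓ)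
      (tateModuleMap ℓ (End.asHom (ρ g)) ∘ₗ tateModuleMap ℓ (frobeniusHom X) ^ m))
    (fun a g ↦ trace_tateModuleMap_asHom_conj_comp_frobeniusHom_pow ℓ ρ a g m)
  simp only [nsmul_eq_mul] at h
  rw [← card_mul_trace_frobeniusHom_pow_image_norm_eq_sum ℓ ρ hN hℓ m, ← mul_assoc] at h
  exact h

variable {c : ratCharIdempotents G → G → ℤ}
  (hc : ∀ e : ratCharIdempotents G,
    (Fintype.card G : ℚ) • (e : MonoidAlgebra ℚ G) = ∑ g, (c e g : ℚ) • MonoidAlgebra.of ℚ G g)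
  {u : ratCharIdempotents G → (X ⟶ X)} (hu : ∀ e, End.of (u e) = ∑ g, c e g • ρ g)

include hc hu in
omit [Fintype H] in
/-- **`|G| · Tr(T_ℓ(π_{B_W})^m | T_ℓ B_W) = Σ_{g ∈ G} c_W(g) · Tr(T_ℓ ρ(g) ∘ T_ℓ(π_X)^m | T_ℓ X)`** for every isotypical factor
`B_W = Im u_W`, `u_W = Σ_g c_W(g) ρ(g)` the integral lift of `|G| e_W` (`W ∈ Irr_ℚ(G)`), over a finite field with `ℓ ∤ q`:
the Frobenius of `B_W` through the `e_W`-weighted twisted Frobenius traces of `X` (at `m = 0`: `2|G| dim B_W = Σ_g c_W(g) χ_ℓ(g)`).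
[cite: LangeRodriguez2022, §2.9.1 Thm. 2.9.1 and Prop. 2.9.3 (PDF pp. 43, 46)] [cite: DokchitserEtAl2022, §3 (additive functor lemma, `F = V_ℓ`)]
[cite: Milne1986AbelianVarieties, §19, proof of Thm. 19.1 (pp. 144–145)] -/
theorem card_mul_trace_frobeniusHom_pow_isotypical_eq_sum (hℓ : (ℓ : K) ≠ 0) (e : ratCharIdempotents G) (m : ℕ) :
    (Fintype.card G : ℤ_[ℓ]) *
        LinearMap.trace ℤ_[ℓ] ((image (u e)).tateModule ℓ) (tateModuleMap ℓ (frobeniusHom (image (u e))) ^ m) =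
      ∑ g, (c e g : ℤ_[ℓ]) *
        LinearMap.trace ℤ_[ℓ] (X.tateModule ℓ) (tateModuleMap ℓ (End.asHom (ρ g)) ∘ₗ tateModuleMap ℓ (frobeniusHom X) ^ m) := by
  rw [← trace_tateModuleMap_frobeniusHom_pow_comp_eq ℓ (comp_self_eq_card_nsmul_isotypical ρ hc hu e) hℓ m,
    isotypical_eq_sum_zsmul_asHom ρ hu e, Preadditive.comp_sum]
  simp_rw [Preadditive.comp_zsmul]
  rw [tateModuleMap_sum_zsmul, map_sum]
  refine Finset.sum_congr rfl fun g _ ↦ ?_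
  rw [map_zsmul, zsmul_eq_mul, tateModuleMap_comp, tateModuleMap_end_pow]

end Twisted

end AbelianVariety

end Literature.AlgebraicGeometry.Motives
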